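import Summits.BirchSwinnertonDyer.BirchSwinnertonDyer.Theorems.ByReductionTypeAtTwoOrdMissingLowerBoundOfLambdaHalf
import Summits.BirchSwinnertonDyer.BirchSwinnertonDyer.Theorems.ByReductionTypeAtTwoOrdEisensteinHalfEquivalence
import Summits.BirchSwinnertonDyer.BirchSwinnertonDyer.Theorems.ByReductionTypeAtTwoMultUpperHalfParity
import Summits.BirchSwinnertonDyer.BirchSwinnertonDyer.Theorems.ByReductionTypeAtTwoAnalyticMuZeroAtTwoHolds
import Summits.BirchSwinnertonDyer.Rank1Residual.F1Sign2.BranchCongruenceModTwoAtTwo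
import Literature.NumberTheory.EllipticCurves.ModularCurvePeriodRatio
import HarnessLib

/-!
# Triage probe (crux-triage r1 seat 1, GEN 5) — item 19577 `OrdMissingLowerBoundAtTwo`, line L1
# `Lines/kato_free_lower_sandwich_two.lean`: the stub `stub_muNonposOfNoRationalTwoTorsion` is CLOSED
# modulo the single PRINT binder `realPeriodRat_eq_unit_mul_plusPeriod_two` (Abbes–Ullmo / GV Rem. 3.4 at 2),
# by tower-1's kernel theorem p641779 `AnalyticMuTwo.analyticMuZeroAtTwo_holds : F1Sign2.AnalyticMuZeroAtTwo`
# (on p641152 `red_ne_zero_of_iwasawaToPowerSeries_eq_padicLFunction_two`) fed into the crux-dir sketch §A.4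
# `KatoFreeSandwich.irreducibleSupply_holds` (body copied verbatim; Cruxes modules are not importable on the farm).
# Nothing is asserted; BSD is not proved; 19577 is not closed by this.
-/

set_option autoImplicit false
set_option linter.dupNamespace false

noncomputable section

open scoped Classical MatrixGroups ModularForm

open CongruenceSubgroup WeierstrassCurve Literature.NumberTheory.EllipticCurves
  Literature.NumberTheory.EllipticCurves.ModularForms Literature.NumberTheory.EllipticCurves.Rank1Residual
  Literature.NumberTheory.EllipticCurves.Rank1Residual.Typed
  Literature.NumberTheory.EllipticCurves.Greenberg1999
  Summit.BirchSwinnertonDyer.Rank1Residual.X1.MuLambda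
  Summit.BirchSwinnertonDyer.Rank1Residual.X1.MuPart
  Summit.BirchSwinnertonDyer.Rank1Residual.X5
  Summit.BirchSwinnertonDyer.Rank1Residual.X5.O1
  Summit.BirchSwinnertonDyer.Rank1Residual
  Summit.BirchSwinnertonDyer.BirchSwinnertonDyer.Theorems.TwoAdicTwistConverse
  Summit.BirchSwinnertonDyer.BirchSwinnertonDyer.Theorems.EisensteinLowerBounds
  Summit.BirchSwinnertonDyer.BirchSwinnertonDyer.Theorems.EisensteinShaCurrency
  Summit.BirchSwinnertonDyer.BirchSwinnertonDyer.Theorems.IsogenyMuShift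

namespace Summit.BirchSwinnertonDyer.BirchSwinnertonDyer.Cruxes.OrdMissingLowerBoundAtTwo.TriageR1Seat1Gen5

variable (W : WeierstrassCurve ℚ) [W.IsElliptic] [W.IsGloballyMinimal]

/-- VERBATIM copy of `KatoFreeSandwich.AnalyticMuNonpos` / L1 `AnalyticMuNonpos` (line file l.100–107). -/
def AnalyticMuNonpos : Prop :=
  ∀ [NeZero (W.conductorNorm ℤ)] (f : CuspForm (Gamma0 (W.conductorNorm ℤ)) 2), IsNewformOf W f →
    ∀ (ϖ : ℚ), (ϖ : ℝ) * W.realPeriodRat = plusPeriod f →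
    ∀ (j : ℕ) (L₀ : IwasawaAlgebra 2),
      iwasawaToPowerSeries 2 L₀ =
        PowerSeries.C (((2 : ℚ) ^ j * ϖ : ℚ) : ℚ_[2]) * padicLFunction f (unitRoot W 2 : ℚ_[2]) →
      mu L₀ ≤ j

/-- §A.4 supply with the conjecture binder `hAμ` DISCHARGED by p641779: body of `irreducibleSupply_holds` verbatim,
`hAμ` replaced by `AnalyticMuTwo.analyticMuZeroAtTwo_holds`. -/
theorem analyticMuNonpos_of_irr_of_abbesUllmoPeriod (hAU : realPeriodRat_eq_unit_mul_plusPeriod_two)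
    (hord : IsOrdinaryAt W 2) (hirr : W.HasIrreducibleModPGaloisRep 2)
    (h2 : ∀ x : ℚ, ¬ HasRationalTwoTorsionX W x) : AnalyticMuNonpos W := by
  intro _ f hf ϖ hϖ j L₀ hL₀
  obtain ⟨u, hu, hΩ⟩ := hAU W hord.1 hirr f hf
  have hϖv : padicValRat 2 ϖ = 0 :=
    Rank1Residual.padicValRat_periodRatio_eq_zero_of_eq_unit_mul W 2 f hu hΩ ϖ hϖ
  have hϖ0 : ϖ ≠ 0 := by
    rintro rfl
    have hper : 0 < plusPeriod f := IsNewform0.plusPeriod_pos_holds hf.1 hf.coeffField_eq_bot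
    rw [← hϖ, Rat.cast_zero, zero_mul] at hper
    exact lt_irrefl _ hper
  have hnorm : ‖(ϖ : ℚ_[2])‖ = 1 := by
    rw [Padic.eq_padicNorm, padicNorm.eq_zpow_of_nonzero hϖ0, hϖv, neg_zero, zpow_zero, Rat.cast_one]
  have hvc : ((PadicInt.mkUnits hnorm : ℤ_[2]ˣ) : ℤ_[2]) = (⟨(ϖ : ℚ_[2]), hnorm.le⟩ : ℤ_[2]) := by
    simp [PadicInt.mkUnits]
  have hvc' : (((PadicInt.mkUnits hnorm : ℤ_[2]ˣ) : ℤ_[2]) : ℚ_[2]) = (ϖ : ℚ_[2]) := by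
    rw [hvc]
  obtain ⟨G, hG⟩ := exists_integral_mul_padicLFunction_two_of_padicValRat_nonneg (W := W) hord hf
    (ϖ := 1) (by simp)
  have hG' : iwasawaToPowerSeries 2 G = padicLFunction f (unitRoot W 2 : ℚ_[2]) := by
    rw [hG, Rat.cast_one, map_one, one_mul]
  have hred : red G ≠ 0 :=
    Summit.BirchSwinnertonDyer.BirchSwinnertonDyer.Theorems.AnalyticMuTwo.analyticMuZeroAtTwo_holds
      W hord h2 f hf G hG'
  have hred₁ : red (PowerSeries.C ((PadicInt.mkUnits hnorm : ℤ_[2]ˣ) : ℤ_[2]) * G) ≠ 0 :=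
    red_C_mul_ne_zero_of_isUnit (PadicInt.mkUnits hnorm).isUnit hred
  have hG₁0 : PowerSeries.C ((PadicInt.mkUnits hnorm : ℤ_[2]ˣ) : ℤ_[2]) * G ≠ 0 := by
    intro h0; rw [h0] at hred₁; exact hred₁ (by simp [red])
  have hμ₁ : mu (PowerSeries.C ((PadicInt.mkUnits hnorm : ℤ_[2]ˣ) : ℤ_[2]) * G) = 0 :=
    (mu_eq_and_pfree_eq hred₁ (by rw [pow_zero, map_one, one_mul])).1
  have hL₀eq : L₀ = PowerSeries.C (((2 : ℕ) : ℤ_[2]) ^ j) *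
      (PowerSeries.C ((PadicInt.mkUnits hnorm : ℤ_[2]ˣ) : ℤ_[2]) * G) := by
    have h2c : ((2 : ℤ_[2]) : ℚ_[2]) = 2 := by simpa using (PadicInt.coe_natCast (p := 2) 2)
    apply iwasawaToPowerSeries_injective (p := 2)
    rw [hL₀, ← hG', map_mul, map_mul, iwasawaToPowerSeries_C, iwasawaToPowerSeries_C, ← mul_assoc,
      ← map_mul, hvc']
    push_cast
    rw [h2c]
  rw [hL₀eq, mu_C_pow_mul hG₁0 j, hμ₁, add_zero]

/-- **L1 stub `stub_muNonposOfNoRationalTwoTorsion` — its statement VERBATIM (line file l.213–215), CLOSED modulo the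
one PRINT binder `hAU`** (`¬ HasCM` and `analyticRank = 0` are not used). -/
theorem stub_muNonposOfNoRationalTwoTorsion_of_abbesUllmoPeriod (hAU : realPeriodRat_eq_unit_mul_plusPeriod_two) :
    ∀ (W : WeierstrassCurve ℚ) [W.IsElliptic] [W.IsGloballyMinimal],
      ¬ W.HasCM → W.analyticRank = 0 → GoodOrd W 2 → (∀ x : ℚ, ¬ HasRationalTwoTorsionX W x) →
      AnalyticMuNonpos W := by
  intro W _ _ _ _ hgo h2
  have hirr : W.HasIrreducibleModPGaloisRep 2 := by
    by_contra h
    obtain ⟨x₀, hx₀⟩ := W.exists_isRoot_twoTorsionPolynomial_of_not_hasIrreducibleModPGaloisRep_two h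
    rw [isRoot_twoTorsionPolynomial_iff] at hx₀
    exact h2 x₀ ((hasRationalTwoTorsionX_iff_twoDivision W x₀).mpr hx₀)
  -- (the binder `[NeZero (W.conductorNorm ℤ)]` inside `AnalyticMuNonpos` is introduced explicitly)
  intro inst f hf ϖ hϖ j L₀ hL₀
  exact analyticMuNonpos_of_irr_of_abbesUllmoPeriod W hAU hgo hirr h2 f hf ϖ hϖ j L₀ hL₀

end Summit.BirchSwinnertonDyer.BirchSwinnertonDyer.Cruxes.OrdMissingLowerBoundAtTwo.TriageR1Seat1Gen5

end
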